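import Summits.AtomisticToContinuum.Crystallization.Theorems.OverbindingBudgetAffineRunCutAxialWindowSix
import Summits.AtomisticToContinuum.Crystallization.Theorems.OverbindingBudgetAffineRunCutColumnGain

/-!
# `OverbindingBudget` / crux `RobustDefectLimitWindows` (stmt-AtomisticToContinuum-31280) — «RunCut»: the column certificates over the axial window

Support file (lens-4 g86, hand-in 3 part 0 for the competitor leaf **SW♭** `StackSwapGainFlat(Wide)`; memo `g86/memo/SW-G1.md` §7).
★ The SWAP / TRIPLE column gains of `…RunCutColumnGain` hold UNCHANGED (`−1/500000`, `−1/250000`) when the interlayer spacing `h = a√t` of the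
column runs over the whole axial window `|t − 2/3| ≤ 1/340` of the competitor's affine charts (own scale `a ∈ [21/25, 101/50]`): the axial line of
the stacking-swap budget is thereby ABSORBED into the certificate (no first-order axial correction is charged any more).  Assembly exactly as parts
C/D of the ideal certificate: the driving layer `…RunCutAxialWindow.windowJ_two_le`, the nineteen layers `…RunCutAxialWindowSix.windowJ_abs_k`
summed, the far layers `…RunCutAxialWindow.far_term_window_le` summed by `sum_inv_pow_Ioc_le`, the margin a convex quadratic in `u = a⁻⁶`
nonpositive at both ends of the box (values `−4.46·10⁻⁶` at `a = 101/50`, `−2.6·10⁻⁴` at `a = 21/25` for TRIPLE), and the column sums through the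
coupling-generic `triple_localEnergyTrunc_le` / `swap_localEnergyTrunc_le` of `…RunCutWord`.
[this file: 0 definitions, 9 theorems; standard axioms]
-/

noncomputable section

namespace Summit.AtomisticToContinuum.Crystallization.Theorems.OverbindingBudgetAffineRunCutAxialWindowGain

open Finset
open Literature.MathematicalPhysics.StatisticalMechanics
open Literature.MathematicalPhysics.StatisticalMechanics.StackingSums
open Summit.AtomisticToContinuum.Crystallization.Theorems.OverbindingBudgetAffineRunCutAxialWindow
open Summit.AtomisticToContinuum.Crystallization.Theorems.OverbindingBudgetAffineRunCutAxialWindowSix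
open Summit.AtomisticToContinuum.Crystallization.Theorems.OverbindingBudgetAffineRunCutWord
open Summit.AtomisticToContinuum.Crystallization.Theorems.OverbindingBudgetAffineRunCutColumnGain (sum_Icc_three_eq_sum_range)

/-- **The nineteen layers over the window, summed**: `∑_{i<19} |J_{i+3}(a, a√t)| ≤ (1/12)a⁻¹²·0.000004790304961 + (1/6)a⁻⁶·0.0000037012`
(the literals are the exact sums of the per-layer literals). [this file · kind: proof] -/
theorem sum_fin_window_le (a : ℝ) {t : ℝ} (ht : |t - 2 / 3| ≤ 1 / 340) :
    ∑ i ∈ range 19, |barlowCoupling lennardJones a (a * Real.sqrt t) (i + 2 + 1)| ≤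
      1 / 12 * (a⁻¹) ^ 12 * 0.000004790304961 + 1 / 6 * (a⁻¹) ^ 6 * 0.0000037012 := by
  have l3 := windowJ_abs_3 a ht
  have l4 := windowJ_abs_4 a ht
  have l5 := windowJ_abs_5 a ht
  have l6 := windowJ_abs_6 a ht
  have l7 := windowJ_abs_7 a ht
  have l8 := windowJ_abs_8 a ht
  have l9 := windowJ_abs_9 a ht
  have l10 := windowJ_abs_10 a ht
  have l11 := windowJ_abs_11 a ht
  have l12 := windowJ_abs_12 a ht
  have l13 := windowJ_abs_13 a ht
  have l14 := windowJ_abs_14 a ht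
  have l15 := windowJ_abs_15 a ht
  have l16 := windowJ_abs_16 a ht
  have l17 := windowJ_abs_17 a ht
  have l18 := windowJ_abs_18 a ht
  have l19 := windowJ_abs_19 a ht
  have l20 := windowJ_abs_20 a ht
  have l21 := windowJ_abs_21 a ht
  simp only [sum_range_succ, sum_range_zero, zero_add, Nat.reduceAdd]
  generalize a⁻¹ ^ 12 = A at *
  generalize a⁻¹ ^ 6 = B at *
  linarith

/-- Far layers over the window, summed: `∑_{m<n} |J_{m+22}(a, a√t)| ≤ ((1/12)a⁻¹²/5000 + (1/6)a⁻⁶·126)·(1/5)·21⁻⁵`. [this file · kind: proof] -/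
theorem far_sum_window_le (a : ℝ) {t : ℝ} (ht : |t - 2 / 3| ≤ 1 / 340) (n : ℕ) :
    ∑ m ∈ range n, |barlowCoupling lennardJones a (a * Real.sqrt t) (m + 21 + 1)| ≤
      (1 / 12 * (a⁻¹) ^ 12 * (1 / 5000) + 1 / 6 * (a⁻¹) ^ 6 * 126) * (1 / 5 * ((21 : ℝ)⁻¹) ^ 5) := by
  have hC : 0 ≤ 1 / 12 * (a⁻¹) ^ 12 * (1 / 5000) + 1 / 6 * (a⁻¹) ^ 6 * 126 := by positivity
  have htail := sum_inv_pow_Ioc_le (d := 5) (by norm_num) (K := 21) (by norm_num) n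
  norm_num at htail
  calc ∑ m ∈ range n, |barlowCoupling lennardJones a (a * Real.sqrt t) (m + 21 + 1)|
      ≤ ∑ m ∈ range n, (1 / 12 * (a⁻¹) ^ 12 * (1 / 5000) + 1 / 6 * (a⁻¹) ^ 6 * 126) * (((m + 21 + 1 : ℕ) : ℝ)⁻¹) ^ 6 :=
        sum_le_sum fun m _ => far_term_window_le a ht m
    _ = (1 / 12 * (a⁻¹) ^ 12 * (1 / 5000) + 1 / 6 * (a⁻¹) ^ 6 * 126) * ∑ m ∈ range n, (((m + 21 + 1 : ℕ) : ℝ)⁻¹) ^ 6 := by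
        rw [← mul_sum]
    _ ≤ (1 / 12 * (a⁻¹) ^ 12 * (1 / 5000) + 1 / 6 * (a⁻¹) ^ 6 * 126) * (1 / 5 * ((21 : ℝ)⁻¹) ^ 5) := by
        refine mul_le_mul_of_nonneg_left ?_ hC
        norm_num
        exact htail

/-- **Every partial sum of the tail over the window is bounded** by the finite part plus the far part. [this file · kind: proof] -/
theorem partial_sum_window_le (a : ℝ) {t : ℝ} (ht : |t - 2 / 3| ≤ 1 / 340) (n : ℕ) :
    ∑ i ∈ range n, |barlowCoupling lennardJones a (a * Real.sqrt t) (i + 2 + 1)| ≤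
      (1 / 12 * (a⁻¹) ^ 12 * 0.000004790304961 + 1 / 6 * (a⁻¹) ^ 6 * 0.0000037012) +
        (1 / 12 * (a⁻¹) ^ 12 * (1 / 5000) + 1 / 6 * (a⁻¹) ^ 6 * 126) * (1 / 5 * ((21 : ℝ)⁻¹) ^ 5) := by
  have hsub : range n ⊆ range (19 + n) := fun x hx => by
    simp only [mem_range] at hx ⊢
    omega
  calc ∑ i ∈ range n, |barlowCoupling lennardJones a (a * Real.sqrt t) (i + 2 + 1)|
      ≤ ∑ i ∈ range (19 + n), |barlowCoupling lennardJones a (a * Real.sqrt t) (i + 2 + 1)| :=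
        sum_le_sum_of_subset_of_nonneg hsub fun i _ _ => abs_nonneg _
    _ = ∑ i ∈ range 19, |barlowCoupling lennardJones a (a * Real.sqrt t) (i + 2 + 1)|
          + ∑ m ∈ range n, |barlowCoupling lennardJones a (a * Real.sqrt t) (19 + m + 2 + 1)| :=
        sum_range_add _ 19 n
    _ = ∑ i ∈ range 19, |barlowCoupling lennardJones a (a * Real.sqrt t) (i + 2 + 1)|
          + ∑ m ∈ range n, |barlowCoupling lennardJones a (a * Real.sqrt t) (m + 21 + 1)| := by
        congr 1
        exact sum_congr rfl fun m _ => by rw [show 19 + m + 2 + 1 = m + 21 + 1 by omega]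
    _ ≤ _ := add_le_add (sum_fin_window_le a ht) (far_sum_window_le a ht n)

/-- **TRIPLE margin over the window, abstract tail**: on the wide box, any `T` below the window tail bound satisfies
`4·J₂(a, a√t) + 6·T ≤ −1/250000` (convex quadratic in `u = a⁻⁶`, nonpositive at both ends). [this file · kind: proof] -/
theorem tripleGain_margin_window_of_le {a : ℝ} (ha1 : 21 / 25 ≤ a) (ha2 : a ≤ 101 / 50) {t : ℝ} (ht : |t - 2 / 3| ≤ 1 / 340) {T : ℝ}
    (hT : T ≤ (1 / 12 * (a⁻¹) ^ 12 * 0.000004790304961 + 1 / 6 * (a⁻¹) ^ 6 * 0.0000037012) +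
        (1 / 12 * (a⁻¹) ^ 12 * (1 / 5000) + 1 / 6 * (a⁻¹) ^ 6 * 126) * (1 / 5 * ((21 : ℝ)⁻¹) ^ 5)) :
    4 * barlowCoupling lennardJones a (a * Real.sqrt t) 2 + 6 * T ≤ -(1 / 250000) := by
  have ha0 : 0 < a := by linarith
  have h2 := windowJ_two_le a ht
  have hlo' : (101 / 50 : ℝ)⁻¹ ≤ a⁻¹ := inv_anti₀ ha0 ha2
  have hhi' : a⁻¹ ≤ (21 / 25 : ℝ)⁻¹ := inv_anti₀ (by norm_num) ha1
  have hinv0 : 0 ≤ a⁻¹ := by positivity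
  have hlo : ((101 / 50 : ℝ)⁻¹) ^ 6 ≤ (a⁻¹) ^ 6 := pow_le_pow_left₀ (by norm_num) hlo' 6
  have hhi : (a⁻¹) ^ 6 ≤ ((21 / 25 : ℝ)⁻¹) ^ 6 := pow_le_pow_left₀ hinv0 hhi' 6
  have e12 : (a⁻¹) ^ 12 = (a⁻¹) ^ 6 * (a⁻¹) ^ 6 := by ring
  rw [e12] at h2 hT
  generalize (a⁻¹) ^ 6 = u at *
  norm_num at hlo hhi
  have key := mul_nonneg (sub_nonneg.2 hlo) (sub_nonneg.2 hhi)
  nlinarith [key, h2, hT, hlo, hhi]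

/-- **SWAP margin over the window, abstract tail**: `2·J₂(a, a√t) + 4·T ≤ −1/500000`. [this file · kind: proof] -/
theorem twinGain_margin_window_of_le {a : ℝ} (ha1 : 21 / 25 ≤ a) (ha2 : a ≤ 101 / 50) {t : ℝ} (ht : |t - 2 / 3| ≤ 1 / 340) {T : ℝ}
    (hT : T ≤ (1 / 12 * (a⁻¹) ^ 12 * 0.000004790304961 + 1 / 6 * (a⁻¹) ^ 6 * 0.0000037012) +
        (1 / 12 * (a⁻¹) ^ 12 * (1 / 5000) + 1 / 6 * (a⁻¹) ^ 6 * 126) * (1 / 5 * ((21 : ℝ)⁻¹) ^ 5)) :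
    2 * barlowCoupling lennardJones a (a * Real.sqrt t) 2 + 4 * T ≤ -(1 / 500000) := by
  have ha0 : 0 < a := by linarith
  have h2 := windowJ_two_le a ht
  have hlo' : (101 / 50 : ℝ)⁻¹ ≤ a⁻¹ := inv_anti₀ ha0 ha2
  have hhi' : a⁻¹ ≤ (21 / 25 : ℝ)⁻¹ := inv_anti₀ (by norm_num) ha1
  have hinv0 : 0 ≤ a⁻¹ := by positivity
  have hlo : ((101 / 50 : ℝ)⁻¹) ^ 6 ≤ (a⁻¹) ^ 6 := pow_le_pow_left₀ (by norm_num) hlo' 6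
  have hhi : (a⁻¹) ^ 6 ≤ ((21 / 25 : ℝ)⁻¹) ^ 6 := pow_le_pow_left₀ hinv0 hhi' 6
  have e12 : (a⁻¹) ^ 12 = (a⁻¹) ^ 6 * (a⁻¹) ^ 6 := by ring
  rw [e12] at h2 hT
  generalize (a⁻¹) ^ 6 = u at *
  norm_num at hlo hhi
  have key := mul_nonneg (sub_nonneg.2 hlo) (sub_nonneg.2 hhi)
  nlinarith [key, h2, hT, hlo, hhi]

/-- **TRIPLE margin over the window with a partial tail sum.** [this file · kind: proof] -/
theorem tripleGain_partial_margin_window {a : ℝ} (ha1 : 21 / 25 ≤ a) (ha2 : a ≤ 101 / 50) {t : ℝ} (ht : |t - 2 / 3| ≤ 1 / 340) (n : ℕ) :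
    4 * barlowCoupling lennardJones a (a * Real.sqrt t) 2
      + 6 * ∑ i ∈ range n, |barlowCoupling lennardJones a (a * Real.sqrt t) (i + 2 + 1)| ≤ -(1 / 250000) :=
  tripleGain_margin_window_of_le ha1 ha2 ht (partial_sum_window_le a ht n)

/-- **SWAP margin over the window with a partial tail sum.** [this file · kind: proof] -/
theorem twinGain_partial_margin_window {a : ℝ} (ha1 : 21 / 25 ≤ a) (ha2 : a ≤ 101 / 50) {t : ℝ} (ht : |t - 2 / 3| ≤ 1 / 340) (n : ℕ) :
    2 * barlowCoupling lennardJones a (a * Real.sqrt t) 2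
      + 4 * ∑ i ∈ range n, |barlowCoupling lennardJones a (a * Real.sqrt t) (i + 2 + 1)| ≤ -(1 / 500000) :=
  twinGain_margin_window_of_le ha1 ha2 ht (partial_sum_window_le a ht n)

/-- ★ **THE TRIPLE COLUMN GAIN OVER THE AXIAL WINDOW**: own scale `a ∈ [21/25, 101/50]`, spacing `h = a√t` with `|t − 2/3| ≤ 1/340`, six equal
steps, `K ≥ 2`, `M ≥ 3`: the range-`K` stacking energy of the column drops by at least `1/250000` under the TRIPLE slip. [this file · kind: proof] -/
theorem triple_column_gain_window {a : ℝ} (ha1 : 21 / 25 ≤ a) (ha2 : a ≤ 101 / 50) {t : ℝ} (ht : |t - 2 / 3| ≤ 1 / 340)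
    {s : ℤ → ℤ} {j : ℤ} (hs : IsHaggSeq s)
    (hrun6 : s (j - 3) = s (j - 2) ∧ s (j - 2) = s (j - 1) ∧ s (j - 1) = s j ∧ s j = s (j + 1) ∧ s (j + 1) = s (j + 2))
    {K M : ℕ} (hK : 2 ≤ K) (hM : 3 ≤ M) :
    ∑ m ∈ Icc (j - M) (j + M),
        (haggLocalEnergyTrunc K (barlowCoupling lennardJones a (a * Real.sqrt t)) (tripleFlip j s) m
          - haggLocalEnergyTrunc K (barlowCoupling lennardJones a (a * Real.sqrt t)) s m) ≤ -(1 / 250000) := by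
  have h1 := triple_localEnergyTrunc_le hs hrun6 (barlowCoupling lennardJones a (a * Real.sqrt t)) hK hM
  rw [sum_Icc_three_eq_sum_range] at h1
  have h2 := tripleGain_partial_margin_window ha1 ha2 ht (K - 2)
  linarith

/-- ★ **THE SWAP COLUMN GAIN OVER THE AXIAL WINDOW**: own scale `a ∈ [21/25, 101/50]`, spacing `h = a√t` with `|t − 2/3| ≤ 1/340`, five equal
steps, `K ≥ 2`, `M ≥ 2`: the column energy drops by at least `1/500000` under the SWAP slip. [this file · kind: proof] -/
theorem swap_column_gain_window {a : ℝ} (ha1 : 21 / 25 ≤ a) (ha2 : a ≤ 101 / 50) {t : ℝ} (ht : |t - 2 / 3| ≤ 1 / 340)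
    {s : ℤ → ℤ} {j : ℤ} (hs : IsHaggSeq s)
    (hrun5 : s (j - 2) = s (j - 1) ∧ s (j - 1) = s j ∧ s j = s (j + 1) ∧ s (j + 1) = s (j + 2))
    {K M : ℕ} (hK : 2 ≤ K) (hM : 2 ≤ M) :
    ∑ m ∈ Icc (j - M) (j + M),
        (haggLocalEnergyTrunc K (barlowCoupling lennardJones a (a * Real.sqrt t)) (swapFlip j s) m
          - haggLocalEnergyTrunc K (barlowCoupling lennardJones a (a * Real.sqrt t)) s m) ≤ -(1 / 500000) := by
  have h1 := swap_localEnergyTrunc_le hs hrun5 (barlowCoupling lennardJones a (a * Real.sqrt t)) hK hM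
  rw [sum_Icc_three_eq_sum_range] at h1
  have h2 := twinGain_partial_margin_window ha1 ha2 ht (K - 2)
  linarith

end Summit.AtomisticToContinuum.Crystallization.Theorems.OverbindingBudgetAffineRunCutAxialWindowGain

end
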